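import Literature.NumberTheory.PAdicHodge.TateGradedInjectivity
import Literature.Algebra.Module.FiltrationAdaptedBasis
import HarnessLib

/-!
# Tate-graded period rings, III: the filtered comparison isomorphism for admissible representations

Topic `Literature/NumberTheory/PAdicHodge`; namespace `Literature.NumberTheory.PAdicHodge.TateGraded`.
THEOREMS ONLY (no definition, no named fact, no instance, no `sorry`); sequel to `TateGradedFiltration`,
`TateGradedInjectivity` (hypotheses `hU`, `hχ`, `hχ0`, `hloc`, `hT0`, `hT1` on an abstract
`PeriodRingData 𝔅` with period ring a field — all hold for `B_dR(F)`).

## Source formalised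

N. Wach, *Représentations p-adiques potentiellement cristallines*, Bull. Soc. Math. France 124 (1996),
§B.2.3, proof of Prop. 2 (p. 394): « L'espace `D = Hom_{ℚ_p[G]}(V, B_dR)` est un `K`-espace vectoriel de
dimension finie `d` muni d'une filtration décroissante et l'application naturelle
`B_dR ⊗_K D → Hom_{ℚ_p}(V, B_dR)` est un isomorphisme de `B_dR`-modules filtrés. Soit `(u_1, …, u_d)` une
base de `D` adaptée à la filtration, c'est-à-dire telle que, si on note `r_i` le plus grand entier tel que
`u_i ∈ Fil^{r_i} D`, alors `Fil^n D = ⊕_{r_i ≥ n} K u_i`. On voit que `Hom_{ℚ_p}(V, B_dR⁺)` est le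
`B_dR⁺`-module libre de base les `t^{-r_i} u_i` ». Read covariantly (`B ⊗_P V` for `Hom(V^*, B)`) and for
an abstract Tate-graded period-ring datum:

* `exists_mem_filTensor`, `eq_zero_of_forall_mem_filTensor` — `Fil^•(B ⊗ V)` is exhaustive and separated;
  `exists_filD_eq_top`, `exists_filD_eq_bot` — so is the Hodge filtration `Fil^• D_B(V)` of the
  finite-dimensional `D_B(V)` (« muni d'une filtration décroissante », finite);
* **`mem_filTensor_iff_repr_mem_fil`** — for a `B`-basis `(e_k)` of `B ⊗ V` made of vectors of `D_B(V)`
  with weights `w_k`, adapted (`e_k ∈ Fil^{w_k}`, no `E`-combination of one weight `i` drops into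
  `Fil^{i+1}`): **`x ∈ Fil^n(B ⊗ V) ↔ ∀ k, (coordinate of x on e_k) ∈ Fil^{n − w_k} B`**, i.e.
  `Fil^n(B ⊗ V) = ⊕_k Fil^{n − w_k} B · e_k` — the filtered isomorphism (« `B_dR⁺`-module libre de base les
  `t^{-r_i} u_i` » is the case `n = 0`). Proof: `⊇` by `Fil^j · Fil^i ⊆ Fil^{i+j}`; `⊆` by descending
  induction from a stage containing all coordinates, each step being the graded injectivity
  `TateGraded.mem_fil_succ_of_sum_smul_mem_filTensor`;
* **`exists_basis_mem_filTensor_iff`** — for `B` a field and `ρ` admissible (`dim_E D_B(V) = dim_P V`: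
  de Rham), such a basis EXISTS: an `E`-basis of `D_B(V)` adapted to `Fil^• D` (tree
  `Literature.Algebra.Module.exists_basis_mem_iff_of_antitone`, Wach's « base adaptée ») is a `B`-basis of
  `B ⊗ V` (Fontaine's comparison isomorphism, tree `exists_basis_extending_of_isAdmissible`).

## References
* N. Wach, Bull. Soc. Math. France 124 (1996), §B.2.3, Prop. 2 and proof (p. 394). [Wach1996]
* J.-M. Fontaine, *Représentations p-adiques semi-stables*, Astérisque 223 (1994), Exp. III, Thm. 1.5.2,
  §1.5.4. [FontaineAsterisque223III]
-/

noncomputable section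

open scoped TensorProduct
open TensorProduct

namespace Literature.NumberTheory.PAdicHodge.TateGraded

open Literature.NumberTheory.GaloisRepresentations
open Literature.NumberTheory.GaloisRepresentations.PeriodRingData

-- Mathlib's own global value; needed for instance problems on `𝔅.B ⊗[P] M` (see `PAdicHodgeProofs`).
set_option maxSynthPendingDepth 3

universe u v v' w w'

variable {Γ : Type u} [Group Γ] {P : Type v} {E : Type v'} [Field P] [Field E] [Algebra P E]
  {M : Type w'} [AddCommGroup M] [Module P M]
  (𝔅 : PeriodRingData.{u, v, v', w} Γ P E) {U : 𝔅.B} {χ : Γ → E}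

/-! ## §1 `Fil^•(B ⊗ V)` and `Fil^• D_B(V)` are exhaustive and separated -/

section Exhaust

/-- **Every `x ∈ B ⊗ V` lies in some `Fil^i(B ⊗ V)`** (`V` finite-dimensional; `Fil^• B` exhaustive).
[cite: FontaineAsterisque223III, Exp. III §1.5.4 (the induced filtration on B ⊗ V)] -/
theorem exists_mem_filTensor [Module.Finite P M] (x : 𝔅.B ⊗[P] M) : ∃ i : ℤ, x ∈ 𝔅.filTensor M i := by
  classical
  let bM := Module.finBasis P M
  obtain ⟨g, rfl⟩ := TensorProduct.eq_repr_basis_right bM x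
  have hsum : (g.sum fun k c => c ⊗ₜ[P] bM k) = ∑ k, g k ⊗ₜ[P] bM k :=
    Finsupp.sum_fintype _ _ fun k => by rw [zero_tmul]
  rw [hsum]
  have hdir : Directed (· ≤ ·) 𝔅.fil := fun i j =>
    ⟨min i j, 𝔅.fil_antitone (min_le_left i j), 𝔅.fil_antitone (min_le_right i j)⟩
  have hk : ∀ k, ∃ j : ℤ, g k ∈ 𝔅.fil j := fun k => by
    have h : g k ∈ (⨆ i, 𝔅.fil i) := by rw [𝔅.iSup_fil]; exact Submodule.mem_top
    exact (Submodule.mem_iSup_of_directed _ hdir).1 h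
  choose j hj using hk
  obtain ⟨i, hi⟩ := (Set.finite_range j).bddBelow
  exact ⟨i, 𝔅.sum_tmul_mem_filTensor bM fun k => 𝔅.fil_antitone (hi ⟨k, rfl⟩) (hj k)⟩

/-- **`⋂_i Fil^i(B ⊗ V) = 0`** (`V` finite-dimensional; `Fil^• B` separated).
[cite: FontaineAsterisque223III, Exp. III §1.5.4 (the induced filtration on B ⊗ V)] -/
theorem eq_zero_of_forall_mem_filTensor [Module.Finite P M] {x : 𝔅.B ⊗[P] M}
    (hx : ∀ i : ℤ, x ∈ 𝔅.filTensor M i) : x = 0 := by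
  classical
  let bM := Module.finBasis P M
  obtain ⟨g, rfl⟩ := TensorProduct.eq_repr_basis_right bM x
  have hsum : (g.sum fun k c => c ⊗ₜ[P] bM k) = ∑ k, g k ⊗ₜ[P] bM k :=
    Finsupp.sum_fintype _ _ fun k => by rw [zero_tmul]
  rw [hsum] at hx ⊢
  have hg : ∀ k, g k = 0 := fun k => by
    have h : g k ∈ (⨅ i, 𝔅.fil i) :=
      (Submodule.mem_iInf _).2 fun i => 𝔅.mem_fil_of_sum_tmul_mem_filTensor bM (hx i) k
    rwa [𝔅.iInf_fil, Submodule.mem_bot] at h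
  exact Finset.sum_eq_zero fun k _ => by rw [hg k, zero_tmul]

variable [TopologicalSpace Γ] [TopologicalSpace P] [TopologicalSpace M] (ρ : ContinuousRep Γ P M)

/-- **The Hodge filtration of a finite-dimensional `D_B(V)` is exhaustive at a finite stage**:
`Fil^a D_B(V) = D_B(V)` for some `a`. [cite: FontaineAsterisque223III, Exp. III §1.5.4 (the induced filtration on D_B(V))] -/
theorem exists_filD_eq_top [Module.Finite P M] [Module.Finite E (𝔅.D ρ)] :
    ∃ a : ℤ, 𝔅.filD ρ a = ⊤ := by
  classical
  let bD := Module.finBasis E (𝔅.D ρ)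
  have hk : ∀ k, ∃ j : ℤ, ((bD k : 𝔅.D ρ) : 𝔅.B ⊗[P] M) ∈ 𝔅.filTensor M j :=
    fun k => exists_mem_filTensor 𝔅 _
  choose j hj using hk
  obtain ⟨a, ha⟩ := (Set.finite_range j).bddBelow
  refine ⟨a, eq_top_iff.2 fun d _ => ?_⟩
  rw [PeriodRingData.mem_filD_iff]
  have hd : ((d : 𝔅.D ρ) : 𝔅.B ⊗[P] M) = ∑ k, bD.repr d k • ((bD k : 𝔅.D ρ) : 𝔅.B ⊗[P] M) := by
    conv_lhs => rw [← bD.sum_repr d]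
    simp only [Submodule.coe_sum, Submodule.coe_smul]
  rw [hd]
  exact Submodule.sum_mem _ fun k _ =>
    Submodule.smul_mem _ _ (filTensor_antitone 𝔅 (ha ⟨k, rfl⟩) (hj k))

/-- **The Hodge filtration of a finite-dimensional `D_B(V)` is separated at a finite stage**:
`Fil^b D_B(V) = 0` for some `b` (the dimensions `dim Fil^i D` decrease to a minimum, attained from some
`i₀` on; that stage lies in every `Fil^i(B ⊗ V)`, hence vanishes).
[cite: FontaineAsterisque223III, Exp. III §1.5.4 (the induced filtration on D_B(V))] -/
theorem exists_filD_eq_bot [Module.Finite P M] [FiniteDimensional E (𝔅.D ρ)] :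
    ∃ b : ℤ, 𝔅.filD ρ b = ⊥ := by
  classical
  let f : ℤ → ℕ := fun i => Module.finrank E (𝔅.filD ρ i)
  have hP : ∃ n : ℕ, ∃ i : ℤ, f i = n := ⟨f 0, 0, rfl⟩
  obtain ⟨i₀, hi₀⟩ := Nat.find_spec hP
  have hmin : ∀ i, f i₀ ≤ f i := fun i => by
    rw [hi₀]
    exact Nat.find_min' hP ⟨i, rfl⟩
  have hconst : ∀ i, i₀ ≤ i → 𝔅.filD ρ i = 𝔅.filD ρ i₀ := fun i hi =>
    Submodule.eq_of_le_of_finrank_le (𝔅.filD_antitone ρ hi) (hmin i)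
  refine ⟨i₀, eq_bot_iff.2 fun d hd => ?_⟩
  rw [Submodule.mem_bot]
  have hall : ∀ i, ((d : 𝔅.D ρ) : 𝔅.B ⊗[P] M) ∈ 𝔅.filTensor M i := by
    intro i
    rcases le_or_gt i₀ i with hi | hi
    · have h : d ∈ 𝔅.filD ρ i := by rw [hconst i hi]; exact hd
      exact h
    · exact (𝔅.filD_antitone ρ hi.le hd : d ∈ 𝔅.filD ρ i)
  exact Subtype.ext (eq_zero_of_forall_mem_filTensor 𝔅 hall)

end Exhaust

/-! ## §2 The filtered comparison -/

section Comparison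

variable [TopologicalSpace Γ] [TopologicalSpace P] [TopologicalSpace M] (ρ : ContinuousRep Γ P M)
  (hU : ∀ (i : ℤ) (x : 𝔅.B), x ∈ 𝔅.fil (i + 1) ↔ ∃ y ∈ 𝔅.fil i, x = U * y)
  (hχ : ∀ σ : Γ, ∃ k ∈ 𝔅.fil 0, σ • U = k * U ∧ k - algebraMap E 𝔅.B (χ σ) ∈ 𝔅.fil 1)
  (hχ0 : ∀ σ : Γ, χ σ ≠ 0)
  (hloc : ∀ b ∈ 𝔅.fil 0, b ∉ 𝔅.fil 1 → ∃ b' ∈ 𝔅.fil 0, b * b' = 1)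
  (hT0 : ∀ b ∈ 𝔅.fil 0, (∀ σ : Γ, σ • b - b ∈ 𝔅.fil 1) → ∃ e : E, b - algebraMap E 𝔅.B e ∈ 𝔅.fil 1)
  (hT1 : ∀ (j : ℤ), j ≠ 0 → ∀ b ∈ 𝔅.fil 0,
    (∀ σ : Γ, σ • b - algebraMap E 𝔅.B (χ σ ^ j) * b ∈ 𝔅.fil 1) → b ∈ 𝔅.fil 1)

include hU hχ hχ0 hloc hT0 hT1 in
/-- **The filtered comparison in an adapted basis** (Wach: « isomorphisme de `B_dR`-modules filtrés …
`Hom_{ℚ_p}(V, B_dR⁺)` est le `B_dR⁺`-module libre de base les `t^{-r_i} u_i` »). For a `B`-basis `(e_k)` of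
`B ⊗ V` consisting of vectors of `D_B(V)` with weights `w_k`, adapted (`e_k ∈ Fil^{w_k}(B ⊗ V)`, and no
`E`-combination of the `e_k` of one weight `i` lies in `Fil^{i+1}(B ⊗ V)` unless trivial):
`x ∈ Fil^n(B ⊗ V) ↔ ∀ k, coordₖ(x) ∈ Fil^{n − w_k} B`, i.e. **`Fil^n(B ⊗ V) = ⊕_k Fil^{n−w_k} B · e_k`**.
[cite: Wach1996, §B.2.3, proof of Prop. 2 (p. 394)] [cite: FontaineAsterisque223III, Exp. III Thm. 1.5.2] -/
theorem mem_filTensor_iff_repr_mem_fil [Module.Finite P M] {ι : Type*} [Fintype ι] [DecidableEq ι]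
    (𝒷 : Module.Basis ι 𝔅.B (𝔅.B ⊗[P] M)) (h𝒷D : ∀ k, 𝒷 k ∈ 𝔅.D ρ) {w : ι → ℤ}
    (h𝒷w : ∀ k, 𝒷 k ∈ 𝔅.filTensor M (w k))
    (hadapt : ∀ (i : ℤ) (a : ι → E), (∀ k, a k ≠ 0 → w k = i) →
      (∑ k, algebraMap E 𝔅.B (a k) • 𝒷 k) ∈ 𝔅.filTensor M (i + 1) → ∀ k, a k = 0)
    (n : ℤ) (x : 𝔅.B ⊗[P] M) :
    x ∈ 𝔅.filTensor M n ↔ ∀ k, 𝒷.repr x k ∈ 𝔅.fil (n - w k) := by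
  constructor
  · intro hx
    -- all coordinates lie in the stages `Fil^{n − t − w_k}` for some common `t : ℕ`
    have hdir : Directed (· ≤ ·) 𝔅.fil := fun i j =>
      ⟨min i j, 𝔅.fil_antitone (min_le_left i j), 𝔅.fil_antitone (min_le_right i j)⟩
    have hk : ∀ k, ∃ j : ℤ, 𝒷.repr x k ∈ 𝔅.fil j := fun k => by
      have h : 𝒷.repr x k ∈ (⨆ i, 𝔅.fil i) := by rw [𝔅.iSup_fil]; exact Submodule.mem_top
      exact (Submodule.mem_iSup_of_directed _ hdir).1 h
    choose j hj using hk
    obtain ⟨t, ht⟩ : ∃ t : ℕ, ∀ k, 𝒷.repr x k ∈ 𝔅.fil (n - t - w k) := by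
      obtain ⟨B, hB⟩ := Finset.bddAbove (Finset.univ.image fun k => n - w k - j k)
      refine ⟨B.toNat, fun k => 𝔅.fil_antitone ?_ (hj k)⟩
      have h := hB (Finset.mem_coe.2 (Finset.mem_image_of_mem _ (Finset.mem_univ k)))
      have := Int.self_le_toNat B
      omega
    -- descend from `n − t` to `n`, one graded step at a time
    suffices H : ∀ t : ℕ, (∀ k, 𝒷.repr x k ∈ 𝔅.fil (n - t - w k)) →
        ∀ k, 𝒷.repr x k ∈ 𝔅.fil (n - w k) from H t ht
    intro t
    induction t with
    | zero => intro h k; simpa using h k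
    | succ t ih =>
      intro h
      apply ih
      have hx' : (∑ k, 𝒷.repr x k • 𝒷 k) ∈ 𝔅.filTensor M ((n - t - 1) + 1) := by
        rw [𝒷.sum_repr x, sub_add_cancel]
        exact filTensor_antitone 𝔅 (by omega) hx
      have hc : ∀ k, 𝒷.repr x k ∈ 𝔅.fil ((n - t - 1) - w k) := fun k => by
        have h1 := h k
        have hidx : n - ((t + 1 : ℕ) : ℤ) - w k = n - t - 1 - w k := by push_cast; ring
        rwa [hidx] at h1
      intro k
      have h1 := mem_fil_succ_of_sum_smul_mem_filTensor 𝔅 ρ hU hχ hχ0 hloc hT0 hT1 h𝒷D h𝒷w hadapt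
        (n - t - 1) (fun k => 𝒷.repr x k) hc hx' k
      have hidx : n - (t : ℤ) - 1 + 1 - w k = n - t - w k := by ring
      rwa [hidx] at h1
  · intro h
    rw [← 𝒷.sum_repr x]
    refine Submodule.sum_mem _ fun k _ => ?_
    have h1 := smul_mem_filTensor 𝔅 (h k) (h𝒷w k)
    have hidx : n - w k + w k = n := by ring
    rwa [hidx] at h1

include hU hχ hχ0 hloc hT0 hT1 in
/-- **The filtered comparison isomorphism for admissible representations over a Tate-graded period ring
whose ring is a field** (Wach 1996, §B.2.3, proof of Prop. 2, for `B_dR`: « `B_dR ⊗_K D → Hom_{ℚ_p}(V, B_dR)`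
est un isomorphisme de `B_dR`-modules filtrés … `Hom(V, B_dR⁺)` est le `B_dR⁺`-module libre de base les
`t^{-r_i} u_i` »). If `ρ` is admissible (`dim_E D_B(V) = dim_P V`), there is a `B`-basis `(e_k)_{k < d}` of
`B ⊗_P V` made of vectors of `D_B(V)` — an `E`-basis of `D_B(V)` adapted to the Hodge filtration
(« base adaptée à la filtration »), with weights `w_k` (`e_k ∈ Fil^{w_k}`) — such that for every `n`:
**`x ∈ Fil^n(B ⊗ V) ↔ ∀ k, coordₖ(x) ∈ Fil^{n − w_k} B`** (`Fil^n(B ⊗ V) = ⊕_k Fil^{n−w_k}B · e_k`).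
[cite: Wach1996, §B.2.3, proof of Prop. 2 (p. 394)] [cite: FontaineAsterisque223III, Exp. III Thm. 1.5.2] -/
theorem exists_basis_mem_filTensor_iff [Module.Finite P M] (hB : IsField 𝔅.B)
    (hadm : 𝔅.IsAdmissible ρ) :
    ∃ (d : ℕ) (𝒷 : Module.Basis (Fin d) 𝔅.B (𝔅.B ⊗[P] M)) (w : Fin d → ℤ),
      (∀ k, 𝒷 k ∈ 𝔅.D ρ) ∧ (∀ k, 𝒷 k ∈ 𝔅.filTensor M (w k)) ∧
      ∀ (n : ℤ) (x : 𝔅.B ⊗[P] M), x ∈ 𝔅.filTensor M n ↔ ∀ k, 𝒷.repr x k ∈ 𝔅.fil (n - w k) := by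
  classical
  rcases subsingleton_or_nontrivial M with hM | hM
  · -- `V = 0`: `B ⊗ V = 0`, the empty basis
    have h0 : ∀ x : 𝔅.B ⊗[P] M, x = 0 := fun x =>
      x.induction_on rfl (fun b m => by rw [Subsingleton.elim m 0, tmul_zero])
        (fun y z hy hz => by rw [hy, hz, add_zero])
    haveI : Subsingleton (𝔅.B ⊗[P] M) := ⟨fun x y => by rw [h0 x, h0 y]⟩
    refine ⟨0, Module.Basis.empty _, Fin.elim0, fun k => k.elim0, fun k => k.elim0, fun n x => ?_⟩
    simp only [IsEmpty.forall_iff, iff_true]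
    rw [h0 x]
    exact Submodule.zero_mem _
  · have hn : 0 < Module.finrank P M := Module.finrank_pos
    have hDpos : 0 < Module.finrank E (𝔅.D ρ) := by rw [hadm]; exact hn
    haveI : Module.Finite E (𝔅.D ρ) := Module.finite_of_finrank_pos hDpos
    obtain ⟨a, ha⟩ := exists_filD_eq_top 𝔅 ρ
    obtain ⟨b, hb⟩ := exists_filD_eq_bot 𝔅 ρ
    obtain ⟨d, eD, w, -, heDw, hadapt⟩ :=
      Literature.Algebra.Module.exists_basis_mem_iff_of_antitone (𝔅.filD ρ) (𝔅.filD_antitone ρ) ha hb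
    have hd : 0 < d := by
      have h := Module.finrank_eq_card_basis eD
      rw [Fintype.card_fin] at h
      omega
    haveI : Nonempty (Fin d) := ⟨⟨0, hd⟩⟩
    obtain ⟨𝒷, h𝒷⟩ := 𝔅.exists_basis_extending_of_isAdmissible ρ hB hadm eD
    have h𝒷D : ∀ k, 𝒷 k ∈ 𝔅.D ρ := fun k => by rw [h𝒷 k]; exact (eD k).2
    have h𝒷w : ∀ k, 𝒷 k ∈ 𝔅.filTensor M (w k) := fun k => by
      rw [h𝒷 k]
      exact (𝔅.mem_filD_iff ρ (w k) (eD k)).1 (heDw k)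
    have hadapt' : ∀ (i : ℤ) (c : Fin d → E), (∀ k, c k ≠ 0 → w k = i) →
        (∑ k, algebraMap E 𝔅.B (c k) • 𝒷 k) ∈ 𝔅.filTensor M (i + 1) → ∀ k, c k = 0 := by
      intro i c hc hmem
      have hsum : (∑ k, algebraMap E 𝔅.B (c k) • 𝒷 k) =
          (((∑ k, c k • eD k : 𝔅.D ρ)) : 𝔅.B ⊗[P] M) := by
        rw [Submodule.coe_sum]
        exact Finset.sum_congr rfl fun k _ => by rw [Submodule.coe_smul, algebraMap_smul, h𝒷 k]
      rw [hsum] at hmem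
      exact Literature.Algebra.Module.eq_zero_of_sum_smul_mem_of_forall_mem_iff _ eD w hadapt i c hc
        ((𝔅.mem_filD_iff ρ (i + 1) _).2 hmem)
    exact ⟨d, 𝒷, w, h𝒷D, h𝒷w, fun n x =>
      mem_filTensor_iff_repr_mem_fil 𝔅 ρ hU hχ hχ0 hloc hT0 hT1 𝒷 h𝒷D h𝒷w hadapt' n x⟩

end Comparison

end Literature.NumberTheory.PAdicHodge.TateGraded

end
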